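import Summits.QuantumFields.YangMills.Theorems.UnitScaleTiltProp7PointLandauBudget
import HarnessLib

/-!
# Route `UnitScaleTilt`, crux K1 «MinimiserStabilityRegPr» (stmt-QuantumFields-19200), route-R under ★p1's RULING (Λ) (2026-08-28 10:04Z) —
# (FV-u-a): THE UNPINNED `ℓ²`-OPTIMAL (LANDAU) REPRESENTATIVE EXISTS on every full gauge orbit (compactness), and (FV-u-b) it is point-Landau at EVERY site
# with divergence budget `6s²·Σ‖Y‖²` and NO centre debit (✓ `Prop7PointLandauBudget`, by name)

Cell `ym3-torus`, keyed width hand `ym-routeR-w1` gen 2 (D-0154 (3c)).  ★p1 g11's S4-curved verdict (bus 10:04:53Z): the PINNED slice is not k-uniform at curved backgrounds,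
the LANDAU slice is; «RE-PEN stub P to the Landau representative … the price moves to S: (FV-u-a) existence of the Landau representative on the pinned-free orbit +
(FV-u-b) first variation there».  THEOREMS ONLY (0 `def`, 0 `sorry`); `--supports stmt-QuantumFields-19200`, count-neutral.  YM₃ on T³ is a ladder rung (R3), not the
Clay problem; nothing here claims the stub, the crux, d = 4 or the mass gap.

THE POINT.  ✓ `Prop7CompactChart.exists_optimalRepr` (★w4-19200) minimises `u ↦ Σ_b‖(W^u)_bU_b^* − 1‖²` over the PINNED group (4); ✓ `Prop7PointLandauBudget` (★routeR-w3 g0)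
proves that an optimum over the FULL orbit is point-Landau at every site (`optimalReprAll_site_stationary`) with `Σ_x‖(D^*_{U₀}Y)(x)‖²_HS ≤ 6s²·Σ‖Y‖²`
(`sum_hs_divB_le_of_optAll`) — both from a DISPLAYED optimality hypothesis `hopt`.  This file supplies `hopt`: the full orbit `SU(n)^{T^{(j)}}` is compact and the
functional continuous, so the minimum is attained (§1, any torus, any `SU(n)`); §2 packages the T³∕`SU(2)` consequences.  What stays DISPLAYED is exactly ★p1's named
price: the sup `s` of the Landau representative (its `ℓ²` distance is at most that of `W′` itself, `sum_normSq_pertVar_optAll_le_self`, but no sup control is claimed),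
and the coarse pure gauge `ū ≠ 1` by which the representative leaves the `(0.4)`-fibre of `U₀`.

WHAT IS PROVED (ns `…Theorems.Prop7OptimalReprAllExists`).
* §1 (`Site P j → SU(n)`, any `P`, `j`, `n`): `continuous_sum_normSq_pertVar_gaugeAct`; ★ `exists_optimalReprAll` (`∃ u, ∀ v, Σ‖pertVar U (W^u)‖² ≤ Σ‖pertVar U (W^v)‖²`);
  ★ `exists_optAll_repr` (the `hopt` shape of ✓ `Prop7PointLandauBudget`: `W := W′^u` is optimal against every further `v`); `sum_normSq_pertVar_optAll_le_self`.
* §1b (★routeR-w2 g1's located (iii), hosted): `norm_pertVar_eq_norm_coe_sub`, `norm_coe_gaugeAct_sub_coe_gaugeAct`, ★ `sum_normSq_pertVar_gaugeAct_background_le`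
  (`Σ‖pertVar U₀ (U₀^u)‖² ≤ 2Σ‖pertVar U₀ W‖² + 2Σ‖pertVar U₀ (W^u)‖²`, any `u`), ★ `…_of_le` (`≤ 4Σ‖pertVar U₀ W‖²` when `u` improves the `ℓ²` distance).
* §2 (T³, `SU(2)`): ★★ `exists_optAll_repr_divBudget` — `∃ u`, `hopt` for `W′^u` ∧ `Σ‖pertVar U₀ (W′^u)‖² ≤ Σ‖pertVar U₀ W′‖²` ∧ drift `Σ‖pertVar U₀ (U₀^u)‖² ≤ 4Σ‖pertVar U₀ W′‖²`
  ∧ `∀ s, (sup ≤ s) → DIV_HS ≤ 6s²·Σ‖pertVar‖²`.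
HONEST SCOPE.  Compactness + two citations of landed theorems; no estimate of Bałaban's is asserted; the sup of the representative and the fibre displacement are not touched.

References: T. Bałaban, CMP 99 (1985) 75–102 [Balaban1985RegularSpaces] ((1.19)–(1.20) p.79, (1.38) p.82); CMP 102 (1985) 277–309 [Balaban1985Variational] ((4) p.278,
(16) p.280); CMP 99 (1985) 389–434 [Balaban1985BackgroundPropagators] ((3.8) p.392).
-/

set_option autoImplicit false

noncomputable section

open scoped BigOperators Matrix.Norms.L2Operator Matrix

namespace Summit.QuantumFields.YangMills.Theorems.Prop7OptimalReprAllExists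

open Literature.MathematicalPhysics.QuantumFieldTheory.Balaban1983to89
open Literature.MathematicalPhysics.QuantumFieldTheory.Balaban1983to89.T3ContinuumYM3Torus
open Literature.MathematicalPhysics.QuantumFieldTheory.Balaban1983to89.T3UnitLawGaugeInvariance (gaugeAct_gaugeAct)
open Finset
open B9Eq39Adjoint (divB)
open B10Eq27TorusAxialLog (unitsField toUField)
open B9TorusCalculus (torusT)
open BlockAveragingEMLLinearisedBackground (pertVar pertVar_eq)
open Summit.QuantumFields.YangMills.Theorems.Prop7PointLandauBudget (optimalReprAll_site_stationary sum_hs_divB_le_of_optAll)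

/-! ## §1 Any torus, `SU(n)`: the `ℓ²` distance along a full gauge orbit attains its minimum -/

section Generic

variable {P : Params} {j : ℕ} {n : Type*} [Fintype n] [DecidableEq n] [Nonempty n]

/-- The functional `u ↦ Σ_b ‖(W^u)_b U_b^* − 1‖²` is continuous on the compact group `SU(n)^{T^{(j)}}`. [folklore] -/
theorem continuous_sum_normSq_pertVar_gaugeAct (U W : GaugeField P j (Matrix.specialUnitaryGroup n ℂ)) :
    Continuous fun u : Site P j → Matrix.specialUnitaryGroup n ℂ =>
      ∑ b : PBond P j, ‖pertVar U (GaugeField.gaugeAct u W) b‖ ^ 2 := by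
  refine continuous_finsetSum _ fun b _ => ?_
  refine Continuous.pow ?_ 2
  have hg : Continuous fun u : Site P j → Matrix.specialUnitaryGroup n ℂ => u b.src * W b * (u b.tgt)⁻¹ :=
    ((continuous_apply b.src).mul continuous_const).mul (continuous_apply b.tgt).inv
  have hc : Continuous fun g : Matrix.specialUnitaryGroup n ℂ => ((g : Matrix n n ℂ) * star ((U b : Matrix.specialUnitaryGroup n ℂ) : Matrix n n ℂ) - 1) :=
    (continuous_subtype_val.mul continuous_const).sub continuous_const
  have := (hc.comp hg).norm
  refine this.congr fun u => ?_
  simp only [Function.comp, pertVar_eq, GaugeField.gaugeAct]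

/-- **EVERY CONFIGURATION HAS AN `ℓ²`-OPTIMAL REPRESENTATIVE ON ITS FULL GAUGE ORBIT** (no pinning): there is `u : T^{(j)} → SU(n)` with
`Σ_b ‖(W^u)_b U_b^* − 1‖² ≤ Σ_b ‖(W^v)_b U_b^* − 1‖²` for every `v` — minimum of a continuous function on the compact group `SU(n)^{T^{(j)}}`; no smallness.
[cite: Balaban1985RegularSpaces, (1.19)-(1.20) p.79; Balaban1985Variational, (16) p.280] -/
theorem exists_optimalReprAll (U W : GaugeField P j (Matrix.specialUnitaryGroup n ℂ)) :
    ∃ u : GaugeTransf P j (Matrix.specialUnitaryGroup n ℂ), ∀ v : GaugeTransf P j (Matrix.specialUnitaryGroup n ℂ),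
      ∑ b : PBond P j, ‖pertVar U (GaugeField.gaugeAct u W) b‖ ^ 2 ≤ ∑ b : PBond P j, ‖pertVar U (GaugeField.gaugeAct v W) b‖ ^ 2 := by
  obtain ⟨u, -, hmin⟩ := (isCompact_univ : IsCompact (Set.univ : Set (Site P j → Matrix.specialUnitaryGroup n ℂ))).exists_isMinOn
    ⟨fun _ => 1, Set.mem_univ _⟩ (continuous_sum_normSq_pertVar_gaugeAct U W).continuousOn
  exact ⟨u, fun v => hmin (Set.mem_univ v)⟩

/-- The same in the `hopt` shape of ✓ `Prop7PointLandauBudget` (the representative `W := W′^u` is optimal against every FURTHER gauge transformation):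
`Σ_b ‖pertVar U W b‖² ≤ Σ_b ‖pertVar U (W^v) b‖²` for all `v`. [cite: Balaban1985RegularSpaces, (1.19)-(1.20) p.79] -/
theorem exists_optAll_repr (U W' : GaugeField P j (Matrix.specialUnitaryGroup n ℂ)) :
    ∃ u : GaugeTransf P j (Matrix.specialUnitaryGroup n ℂ), ∀ v : GaugeTransf P j (Matrix.specialUnitaryGroup n ℂ),
      ∑ b : PBond P j, ‖pertVar U (GaugeField.gaugeAct u W') b‖ ^ 2 ≤
        ∑ b : PBond P j, ‖pertVar U (GaugeField.gaugeAct v (GaugeField.gaugeAct u W')) b‖ ^ 2 := by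
  obtain ⟨u, hmin⟩ := exists_optimalReprAll U W'
  exact ⟨u, fun v => by rw [gaugeAct_gaugeAct]; exact hmin _⟩

/-- The optimum is at least as close to the background as the configuration itself (`v = 1`). [folklore] -/
theorem sum_normSq_pertVar_optAll_le_self (U W' : GaugeField P j (Matrix.specialUnitaryGroup n ℂ))
    {u : GaugeTransf P j (Matrix.specialUnitaryGroup n ℂ)}
    (hmin : ∀ v : GaugeTransf P j (Matrix.specialUnitaryGroup n ℂ),
      ∑ b : PBond P j, ‖pertVar U (GaugeField.gaugeAct u W') b‖ ^ 2 ≤ ∑ b : PBond P j, ‖pertVar U (GaugeField.gaugeAct v W') b‖ ^ 2) :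
    ∑ b : PBond P j, ‖pertVar U (GaugeField.gaugeAct u W') b‖ ^ 2 ≤ ∑ b : PBond P j, ‖pertVar U W' b‖ ^ 2 := by
  have h := hmin (fun _ => 1)
  have e : GaugeField.gaugeAct (fun _ => (1 : Matrix.specialUnitaryGroup n ℂ)) W' = W' := by
    funext b; simp [GaugeField.gaugeAct]
  rwa [e] at h


/-! ### §1b The `ℓ²` drift of the background under the optimal transformation (LOCATED by ★routeR-w2 g1, 2026-08-28 10:16Z (iii); hosted here at his «HOST») -/

omit [Nonempty n] in
/-- `‖Y_b(X, V)‖ = ‖X_b − V_b‖` (unitarity of `V_b`). [cite: Balaban1985Variational, (15) p.280] -/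
theorem norm_pertVar_eq_norm_coe_sub (V X : GaugeField P j (Matrix.specialUnitaryGroup n ℂ)) (b : PBond P j) :
    ‖pertVar V X b‖ = ‖((X b : Matrix.specialUnitaryGroup n ℂ) : Matrix n n ℂ) - ((V b : Matrix.specialUnitaryGroup n ℂ) : Matrix n n ℂ)‖ := by
  rw [pertVar_eq]
  have e : ((X b : Matrix.specialUnitaryGroup n ℂ) : Matrix n n ℂ) * star ((V b : Matrix.specialUnitaryGroup n ℂ) : Matrix n n ℂ) - 1
      = (((X b : Matrix.specialUnitaryGroup n ℂ) : Matrix n n ℂ) - ((V b : Matrix.specialUnitaryGroup n ℂ) : Matrix n n ℂ)) * star ((V b : Matrix.specialUnitaryGroup n ℂ) : Matrix n n ℂ) := by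
    rw [sub_mul, Unitary.mul_star_self_of_mem (V b).2.1]
  rw [e, CStarRing.norm_mul_mem_unitary _ (Unitary.star_mem (V b).2.1)]

/-- A simultaneous gauge transformation preserves bondwise distances: `‖(X^u)_b − (V^u)_b‖ = ‖X_b − V_b‖`. [cite: Balaban1985Averaging, (8) p.19] -/
theorem norm_coe_gaugeAct_sub_coe_gaugeAct (u : GaugeTransf P j (Matrix.specialUnitaryGroup n ℂ)) (X V : GaugeField P j (Matrix.specialUnitaryGroup n ℂ)) (b : PBond P j) :
    ‖((GaugeField.gaugeAct u X b : Matrix.specialUnitaryGroup n ℂ) : Matrix n n ℂ) - ((GaugeField.gaugeAct u V b : Matrix.specialUnitaryGroup n ℂ) : Matrix n n ℂ)‖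
      = ‖((X b : Matrix.specialUnitaryGroup n ℂ) : Matrix n n ℂ) - ((V b : Matrix.specialUnitaryGroup n ℂ) : Matrix n n ℂ)‖ := by
  have hcoe : ∀ Z : GaugeField P j (Matrix.specialUnitaryGroup n ℂ), ((GaugeField.gaugeAct u Z b : Matrix.specialUnitaryGroup n ℂ) : Matrix n n ℂ)
      = ((u b.src : Matrix.specialUnitaryGroup n ℂ) : Matrix n n ℂ) * ((Z b : Matrix.specialUnitaryGroup n ℂ) : Matrix n n ℂ) * star ((u b.tgt : Matrix.specialUnitaryGroup n ℂ) : Matrix n n ℂ) := by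
    intro Z
    show (((u b.src * Z b * (u b.tgt)⁻¹ : Matrix.specialUnitaryGroup n ℂ)) : Matrix n n ℂ) = _
    rw [Submonoid.coe_mul, Submonoid.coe_mul]
    rfl
  rw [hcoe, hcoe, ← sub_mul, ← mul_sub, CStarRing.norm_mul_mem_unitary _ (Unitary.star_mem (u b.tgt).2.1),
    CStarRing.norm_mem_unitary_mul _ (u b.src).2.1]

/-- ★ **THE `ℓ²` DRIFT OF THE BACKGROUND UNDER ANY GAUGE TRANSFORMATION** (★routeR-w2 g1's located (iii), generic form): for every `u`,
`Σ_b‖(U₀^u)_bU₀(b)^* − 1‖² ≤ 2·Σ_b‖W_bU₀(b)^* − 1‖² + 2·Σ_b‖(W^u)_bU₀(b)^* − 1‖²` — bondwise `‖U₀^u − U₀‖ ≤ ‖U₀^u − W^u‖ + ‖W^u − U₀‖ = ‖U₀ − W‖ + ‖W^u − U₀‖`.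
So a transformation that keeps `W` `ℓ²`-close to `U₀` is `U₀`-covariantly near-constant in `ℓ²`. [cite: Balaban1985Variational, (15)-(16) p.280] -/
theorem sum_normSq_pertVar_gaugeAct_background_le (U₀ W : GaugeField P j (Matrix.specialUnitaryGroup n ℂ)) (u : GaugeTransf P j (Matrix.specialUnitaryGroup n ℂ)) :
    ∑ b : PBond P j, ‖pertVar U₀ (GaugeField.gaugeAct u U₀) b‖ ^ 2 ≤
      2 * ∑ b : PBond P j, ‖pertVar U₀ W b‖ ^ 2 + 2 * ∑ b : PBond P j, ‖pertVar U₀ (GaugeField.gaugeAct u W) b‖ ^ 2 := by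
  rw [Finset.mul_sum, Finset.mul_sum, ← Finset.sum_add_distrib]
  refine Finset.sum_le_sum fun b _ => ?_
  rw [norm_pertVar_eq_norm_coe_sub, norm_pertVar_eq_norm_coe_sub, norm_pertVar_eq_norm_coe_sub]
  have htri : ‖((GaugeField.gaugeAct u U₀ b : Matrix.specialUnitaryGroup n ℂ) : Matrix n n ℂ) - ((U₀ b : Matrix.specialUnitaryGroup n ℂ) : Matrix n n ℂ)‖
      ≤ ‖((W b : Matrix.specialUnitaryGroup n ℂ) : Matrix n n ℂ) - ((U₀ b : Matrix.specialUnitaryGroup n ℂ) : Matrix n n ℂ)‖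
        + ‖((GaugeField.gaugeAct u W b : Matrix.specialUnitaryGroup n ℂ) : Matrix n n ℂ) - ((U₀ b : Matrix.specialUnitaryGroup n ℂ) : Matrix n n ℂ)‖ := by
    have h1 := norm_coe_gaugeAct_sub_coe_gaugeAct u U₀ W b
    have h2 := norm_sub_le_norm_sub_add_norm_sub (((GaugeField.gaugeAct u U₀ b : Matrix.specialUnitaryGroup n ℂ) : Matrix n n ℂ))
      (((GaugeField.gaugeAct u W b : Matrix.specialUnitaryGroup n ℂ) : Matrix n n ℂ)) (((U₀ b : Matrix.specialUnitaryGroup n ℂ) : Matrix n n ℂ))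
    rw [h1, norm_sub_rev ((U₀ b : Matrix.specialUnitaryGroup n ℂ) : Matrix n n ℂ)] at h2
    exact h2
  set a := ‖((W b : Matrix.specialUnitaryGroup n ℂ) : Matrix n n ℂ) - ((U₀ b : Matrix.specialUnitaryGroup n ℂ) : Matrix n n ℂ)‖
  set c := ‖((GaugeField.gaugeAct u W b : Matrix.specialUnitaryGroup n ℂ) : Matrix n n ℂ) - ((U₀ b : Matrix.specialUnitaryGroup n ℂ) : Matrix n n ℂ)‖
  set x := ‖((GaugeField.gaugeAct u U₀ b : Matrix.specialUnitaryGroup n ℂ) : Matrix n n ℂ) - ((U₀ b : Matrix.specialUnitaryGroup n ℂ) : Matrix n n ℂ)‖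
  have hx : 0 ≤ x := norm_nonneg _
  have hsq : x * x ≤ (a + c) * (a + c) := mul_le_mul htri htri hx (hx.trans htri)
  nlinarith [hsq, sq_nonneg (a - c)]

/-- ★ **AT AN `ℓ²`-IMPROVING TRANSFORMATION THE DRIFT IS `≤ 4·Σ‖Y‖²`**: if `Σ‖pertVar U₀ (W^u)‖² ≤ Σ‖pertVar U₀ W‖²` (in particular at the optimum of `exists_optimalReprAll`,
by `sum_normSq_pertVar_optAll_le_self`), then `Σ_b‖(U₀^u)_bU₀(b)^* − 1‖² ≤ 4·Σ_b‖W_bU₀(b)^* − 1‖²`. [cite: Balaban1985Variational, (15)-(16) p.280] -/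
theorem sum_normSq_pertVar_gaugeAct_background_le_of_le (U₀ W : GaugeField P j (Matrix.specialUnitaryGroup n ℂ))
    {u : GaugeTransf P j (Matrix.specialUnitaryGroup n ℂ)}
    (hle : ∑ b : PBond P j, ‖pertVar U₀ (GaugeField.gaugeAct u W) b‖ ^ 2 ≤ ∑ b : PBond P j, ‖pertVar U₀ W b‖ ^ 2) :
    ∑ b : PBond P j, ‖pertVar U₀ (GaugeField.gaugeAct u U₀) b‖ ^ 2 ≤ 4 * ∑ b : PBond P j, ‖pertVar U₀ W b‖ ^ 2 := by
  have h := sum_normSq_pertVar_gaugeAct_background_le U₀ W u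
  linarith

end Generic

/-! ## §2 T³, `SU(2)`: the unpinned optimum is point-Landau everywhere and carries the divergence budget `6s²` with NO centre debit -/

/-- ★ **THE LANDAU (UNPINNED `ℓ²`-OPTIMAL) REPRESENTATIVE EXISTS AND ITS DIVERGENCE BUDGET IS `6s²·Σ‖Y‖²`** (d = 3 carrier): for every background `U₀` and every
configuration `W′` there is a gauge transformation `u` of the finest torus such that `W := W′^u` is `ℓ²`-optimal over its FULL orbit relative to `U₀` (so ✓
`Prop7PointLandauBudget.optimalReprAll_site_stationary` makes it point-Landau at EVERY site), its `ℓ²` distance and the `ℓ²` drift `Σ‖(U₀^u)U₀^* − 1‖²` are at most `1×` ∕ `4×`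
that of `W′`, and whenever `‖W_b U₀(b)^* − 1‖ ≤ s` bondwise,
`Σ_x ‖(D^*_{U₀}Y)(x)‖²_HS ≤ 6s²·Σ_b‖Y_b‖²`, `Y = W U₀^* − 1` (✓ `sum_hs_divB_le_of_optAll`).  The sup `s` of the representative is DISPLAYED (not controlled here).
[cite: Balaban1985RegularSpaces, (1.19)-(1.20) p.79, (1.38) p.82; Balaban1985BackgroundPropagators, (3.8) p.392] -/
theorem exists_optAll_repr_divBudget (F : T3Family) (K : ℕ) (U₀ W' : GaugeField (F.P K) 0 (Matrix.specialUnitaryGroup (Fin 2) ℂ)) :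
    ∃ u : GaugeTransf (F.P K) 0 (Matrix.specialUnitaryGroup (Fin 2) ℂ),
      (∀ v : GaugeTransf (F.P K) 0 (Matrix.specialUnitaryGroup (Fin 2) ℂ),
        ∑ b : PBond (F.P K) 0, ‖pertVar U₀ (GaugeField.gaugeAct u W') b‖ ^ 2 ≤
          ∑ b : PBond (F.P K) 0, ‖pertVar U₀ (GaugeField.gaugeAct v (GaugeField.gaugeAct u W')) b‖ ^ 2) ∧
      (∑ b : PBond (F.P K) 0, ‖pertVar U₀ (GaugeField.gaugeAct u W') b‖ ^ 2 ≤ ∑ b : PBond (F.P K) 0, ‖pertVar U₀ W' b‖ ^ 2) ∧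
      (∑ b : PBond (F.P K) 0, ‖pertVar U₀ (GaugeField.gaugeAct u U₀) b‖ ^ 2 ≤ 4 * ∑ b : PBond (F.P K) 0, ‖pertVar U₀ W' b‖ ^ 2) ∧
      ∀ s : ℝ, (∀ b : PBond (F.P K) 0, ‖pertVar U₀ (GaugeField.gaugeAct u W') b‖ ≤ s) →
        ∑ x : Site (F.P K) 0, ∑ j : Fin 2, ∑ k : Fin 2,
            ‖(divB (torusT (F.P K) 0) (fun κ z => unitsField (toUField U₀) ⟨z, κ⟩)
              (fun κ z => pertVar U₀ (GaugeField.gaugeAct u W') ⟨z, κ⟩) x) j k‖ ^ 2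
          ≤ 6 * s ^ 2 * ∑ b : PBond (F.P K) 0, ‖pertVar U₀ (GaugeField.gaugeAct u W') b‖ ^ 2 := by
  obtain ⟨u, hmin⟩ := exists_optimalReprAll U₀ W'
  have hopt : ∀ v : GaugeTransf (F.P K) 0 (Matrix.specialUnitaryGroup (Fin 2) ℂ),
      ∑ b : PBond (F.P K) 0, ‖pertVar U₀ (GaugeField.gaugeAct u W') b‖ ^ 2 ≤
        ∑ b : PBond (F.P K) 0, ‖pertVar U₀ (GaugeField.gaugeAct v (GaugeField.gaugeAct u W')) b‖ ^ 2 :=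
    fun v => by rw [gaugeAct_gaugeAct]; exact hmin _
  refine ⟨u, hopt, sum_normSq_pertVar_optAll_le_self U₀ W' hmin,
    sum_normSq_pertVar_gaugeAct_background_le_of_le U₀ W' (sum_normSq_pertVar_optAll_le_self U₀ W' hmin), fun s hs => ?_⟩
  have h := sum_hs_divB_le_of_optAll F U₀ (GaugeField.gaugeAct u W') hopt (s := s) (fun b => by rw [← pertVar_eq]; exact hs b)
  simpa only [← pertVar_eq] using h

end Summit.QuantumFields.YangMills.Theorems.Prop7OptimalReprAllExists

end
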